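import Summits.FinalStateConjecture.FinalStateConjecture.Theorems.NearExtremalKappaCapture.Negative.ExtremalGerm
import HarnessLib.Audit.CruxProbe

/-!
# Strategist r1 — Decomposition attempt D-r1-2 (typed signatures, NOT filed):
# `NearExtremalKappaCapture ⇐ OrbitalKappaCapture + AsymptoticFromOrbital`  (orbital | rigidity split)

Second-opinion artefact for STRATEGY-CENSUS-r1.md §4 (crux stmt-FinalStateConjecture-10606). The split of a
nonlinear asymptotic-stability statement that does NOT run through a linear law (p1's K2) nor through time
(dead line unit-temperature) nor through conservation laws (dead line area-excess): by CONCLUSION STRENGTH,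
into an ORBITAL half (global existence + far-complete `𝓘⁺` + a late-embedded region REMAINING
`Cχ^{-p}√dist`-close to the INITIAL Kerr `g_{M,a}` in `C^k`, `Spacetime.RemainsCloseToKerr`) and a RIGIDITY
half (a vacuum MGHD region that remains `ε`-close to `g_{M,a}` for all late chart times, `ε ≤ ε₀ χ^q`,
converges in `C⁰` to SOME sub-extremal `g_{M',a'}` with `|M' − M| + |a' − a| ≤ C' χ^{-p'} ε` — "orbital ⇒
asymptotic", the Martel–Merle / Liouville architecture, whose stationary end is the landed-in-print local
uniqueness of Kerr among stationary vacuum black holes close to Kerr, Alexakis–Ionescu–Klainerman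
arXiv:0904.0982).

Both pieces are genuine in ledger logic (neither is the crux reworded: the orbital half has no convergence
and no final parameters, the rigidity half is local to one development and has no basin), the glue is
elementary exponent bookkeeping, KERNEL-CHECKED below (`NearExtremalKappaCapture_of_orbital_asymptotic`:
`k` matched, `γ' = max γ (2(p+q))`, `c' = min c (ε₀/(max C 0 + 1))²`, `p'' = p + p'`), and neither piece is
implied by or implies the summit. It is NOT filed (`route edit --split` not run) for the two reasons recorded in the census:
(d) neither piece has a typable skeleton today (no local existence / gauge / linearised gravity on dynamical
metrics in the tree), and the orbital half is the crux's whole difficulty in practice (for quasilinear waves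
in 3+1 dimensions no method yields global smallness without decay: orbital control over infinite time needs
time-integrable nonlinear errors). `lean check` rc 0, 0 sorry.
-/

noncomputable section

set_option linter.dupNamespace false

namespace Summit.FinalStateConjecture.FinalStateConjecture.Cruxes.NearExtremalKappaCapture.StrategistR1

open Literature.Geometry.Lorentzian
open Summit.FinalStateConjecture.FinalStateConjecture.Theorems.NearExtremalKappaCapture.Negative
open scoped Manifold ContDiff Topology ENNReal
open Set Filter

/-- **Orbital κ-capture at fixed exponents** (piece 1 body): the crux's quantifier prefix and basin
`c χ^γ`, with conclusion: far-complete `𝓘⁺` and a region REMAINING `C χ^{-p} √dist`-close in `C^k` to the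
INITIAL Kerr exterior `g_{M,a}` (`Spacetime.RemainsCloseToKerr`; no convergence, no final parameters). -/
def OrbitalCaptureWith [Kerr.Facts] [Kerr.SliceFacts] (s : ℕ) (δ : ℝ) (k : ℕ) (γ p a₁ : ℝ) : Prop :=
  ∀ (M : ℝ) (hM : 0 < M), ∃ c > (0 : ℝ), ∃ C : ℝ, ∀ a : ℝ, a₁ * M ≤ |a| →
    Kerr.IsSubextremal M a →
      ∀ (D : InitialDataSet 𝓘(ℝ, E3) (Kerr.slice a M)) [D.metric.HasLeviCivita],
        D.IsVacuumConstraintSolution →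
          InitialDataSet.dataWeightedSobolevEDist s δ D (Kerr.data M a M hM.le) <
              ENNReal.ofReal (c * (1 - (a / M) ^ 2) ^ γ) →
            ∀ 𝒟 : VacuumCauchyDevelopment D, 𝒟.IsMaximal →
              FarComplete 𝒟 ∧ ∃ 𝒟oc : Set 𝒟.carrier,
                𝒟.toSpacetime.RemainsCloseToKerr 𝒟oc M a k
                  (ENNReal.ofReal (C * (1 - (a / M) ^ 2) ^ (-p) *
                    √(InitialDataSet.dataWeightedSobolevEDist s δ D (Kerr.data M a M hM.le)).toReal))

/-- **Piece 1 — orbital κ-capture at every closeness order `k`** (the consumer, piece 2, picks `k`). -/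
def OrbitalKappaCapture : Prop :=
  ∀ [Kerr.Facts] [Kerr.SliceFacts], ∀ k : ℕ, ∃ (s : ℕ) (δ : ℝ) (γ p a₁ : ℝ), a₁ < 1 ∧
    OrbitalCaptureWith s δ k γ p a₁

/-- **Piece 2 — asymptotic stability from orbital stability, κ-polynomial** (rigidity half; local to one
maximal vacuum Cauchy development; no basin): there are a closeness order `k` and exponents `(q, p')` such
that for every `M > 0` some `ε₀ > 0`, `C'` give: for every sub-extremal spin `a`, every vacuum datum on
`Kerr.slice a M`, every MGHD `𝒟`, every region `𝒟oc` and every `0 ≤ ε ≤ ε₀ χ^q`, if `𝒟` REMAINS `ε`-close to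
`g_{M,a}` in `C^k` on `𝒟oc` then some region converges in `C⁰` to a SUB-extremal `g_{M',a'}` with
`|M' − M| + |a' − a| ≤ C' χ^{-p'} ε`. -/
def AsymptoticFromOrbital : Prop :=
  ∀ [Kerr.Facts] [Kerr.SliceFacts], ∃ (k : ℕ) (q p' : ℝ), ∀ (M : ℝ), 0 < M → ∃ ε₀ > (0 : ℝ), ∃ C' : ℝ,
    ∀ a : ℝ, Kerr.IsSubextremal M a →
      ∀ (D : InitialDataSet 𝓘(ℝ, E3) (Kerr.slice a M)) [D.metric.HasLeviCivita]
        (𝒟 : VacuumCauchyDevelopment D), 𝒟.IsMaximal →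
          ∀ (𝒟oc : Set 𝒟.carrier) (ε : ℝ), 0 ≤ ε → ε ≤ ε₀ * (1 - (a / M) ^ 2) ^ q →
            𝒟.toSpacetime.RemainsCloseToKerr 𝒟oc M a k (ENNReal.ofReal ε) →
              ∃ (M' a' : ℝ) (𝒟oc' : Set 𝒟.carrier), Kerr.IsSubextremal M' a' ∧
                𝒟.toSpacetime.ConvergesToKerr 𝒟oc' M' a' 0 ∧
                  |M' - M| + |a' - a| ≤ C' * (1 - (a / M) ^ 2) ^ (-p') * ε

/-! ## The glue (kernel-checked): piece 1 → piece 2 → crux -/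

/-- **`NearExtremalKappaCapture_of_orbital_asymptotic`**: orbital κ-capture at every closeness order plus
κ-polynomial rigidity give the crux, at the exponent vector
`(s, δ, 0, max γ (2(p+q)), p + p', a₁)` with basin constant `min c (ε₀/(max C 0 + 1))²` and modulus
constant `max C' 0 · max C 0`: inside the shrunk basin the orbital radius `max C 0 · χ^{-p} √dist` is at
most `ε₀ χ^q`, so piece 2 applies to the region delivered by piece 1. Elementary exponent bookkeeping. -/
theorem NearExtremalKappaCapture_of_orbital_asymptotic (h₁ : OrbitalKappaCapture)
    (h₂ : AsymptoticFromOrbital) : Theses.PhaseMixingCapture.NearExtremalKappaCapture := by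
  refine near_iff.mpr ?_
  intro hF hS
  obtain ⟨k, q, p', H₂⟩ := @h₂ hF hS
  obtain ⟨s, δ, γ, p, a₁, ha₁, H₁⟩ := @h₁ hF hS k
  refine ⟨s, δ, 0, max γ (2 * (p + q)), p + p', a₁, ha₁, fun M hM ↦ ?_⟩
  obtain ⟨c, hc, C, H₁M⟩ := H₁ M hM
  obtain ⟨ε₀, hε₀, C', H₂M⟩ := H₂ M hM
  have hC0 : 0 ≤ max C 0 := le_max_right _ _
  have hK : 0 < max C 0 + 1 := by linarith
  have hεK : 0 < ε₀ / (max C 0 + 1) := div_pos hε₀ hK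
  refine ⟨min c ((ε₀ / (max C 0 + 1)) ^ 2), lt_min hc (pow_pos hεK 2), max C' 0 * max C 0,
    fun a ha hsub D _ hvac hdist 𝒟 hmax ↦ ?_⟩
  obtain ⟨hx0, hx1⟩ := kappaSq_pos_le_one hsub
  have hc₂c : min c ((ε₀ / (max C 0 + 1)) ^ 2) ≤ c := min_le_left _ _
  have hc₂pos : 0 < min c ((ε₀ / (max C 0 + 1)) ^ 2) := lt_min hc (pow_pos hεK 2)
  -- (i) the shrunk basin lies in piece 1's basin
  have hxγ : (1 - (a / M) ^ 2) ^ max γ (2 * (p + q)) ≤ (1 - (a / M) ^ 2) ^ γ :=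
    Real.rpow_le_rpow_of_exponent_ge hx0 hx1 (le_max_left _ _)
  have hdist₁ : InitialDataSet.dataWeightedSobolevEDist s δ D (Kerr.data M a M hM.le) <
      ENNReal.ofReal (c * (1 - (a / M) ^ 2) ^ γ) :=
    hdist.trans_le (ENNReal.ofReal_le_ofReal
      (mul_le_mul hc₂c hxγ (Real.rpow_nonneg hx0.le _) hc.le))
  obtain ⟨hfar, 𝒟oc, hclose⟩ := H₁M a ha hsub D hvac hdist₁ 𝒟 hmax
  -- (ii) the closeness radius handed to piece 2
  set d : ℝ := (InitialDataSet.dataWeightedSobolevEDist s δ D (Kerr.data M a M hM.le)).toReal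
    with hd
  have hd0 : 0 ≤ d := ENNReal.toReal_nonneg
  have hpow : 0 ≤ (1 - (a / M) ^ 2) ^ (-p) := Real.rpow_nonneg hx0.le _
  have hε0 : 0 ≤ max C 0 * (1 - (a / M) ^ 2) ^ (-p) * √d :=
    mul_nonneg (mul_nonneg hC0 hpow) (Real.sqrt_nonneg _)
  have hclose' : 𝒟.toSpacetime.RemainsCloseToKerr 𝒟oc M a k
      (ENNReal.ofReal (max C 0 * (1 - (a / M) ^ 2) ^ (-p) * √d)) :=
    Spacetime.RemainsCloseTo.mono hclose (ENNReal.ofReal_le_ofReal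
      (mul_le_mul_of_nonneg_right (mul_le_mul_of_nonneg_right (le_max_left _ _) hpow)
        (Real.sqrt_nonneg _)))
  -- (iii) the handed radius is at most `ε₀ χ^q`
  have hdlt : d < min c ((ε₀ / (max C 0 + 1)) ^ 2) * (1 - (a / M) ^ 2) ^ max γ (2 * (p + q)) :=
    ENNReal.toReal_lt_of_lt_ofReal hdist
  have hxg : 0 ≤ (1 - (a / M) ^ 2) ^ (max γ (2 * (p + q)) / 2) := Real.rpow_nonneg hx0.le _
  have hsq : (√(min c ((ε₀ / (max C 0 + 1)) ^ 2)) * (1 - (a / M) ^ 2) ^ (max γ (2 * (p + q)) / 2)) ^ 2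
      = min c ((ε₀ / (max C 0 + 1)) ^ 2) * (1 - (a / M) ^ 2) ^ max γ (2 * (p + q)) := by
    rw [mul_pow, Real.sq_sqrt hc₂pos.le, ← Real.rpow_natCast ((1 - (a / M) ^ 2) ^ _) 2,
      ← Real.rpow_mul hx0.le]
    norm_num
  have hsqrt_d : √d ≤ √(min c ((ε₀ / (max C 0 + 1)) ^ 2)) *
      (1 - (a / M) ^ 2) ^ (max γ (2 * (p + q)) / 2) := by
    rw [← Real.sqrt_sq (mul_nonneg (Real.sqrt_nonneg _) hxg), hsq]
    exact Real.sqrt_le_sqrt hdlt.le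
  have hsqrt_c₂ : √(min c ((ε₀ / (max C 0 + 1)) ^ 2)) ≤ ε₀ / (max C 0 + 1) :=
    calc √(min c ((ε₀ / (max C 0 + 1)) ^ 2)) ≤ √((ε₀ / (max C 0 + 1)) ^ 2) :=
          Real.sqrt_le_sqrt (min_le_right _ _)
      _ = ε₀ / (max C 0 + 1) := Real.sqrt_sq hεK.le
  have hexp : (1 - (a / M) ^ 2) ^ (-p) * (1 - (a / M) ^ 2) ^ (max γ (2 * (p + q)) / 2) ≤
      (1 - (a / M) ^ 2) ^ q := by
    rw [← Real.rpow_add hx0]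
    refine Real.rpow_le_rpow_of_exponent_ge hx0 hx1 ?_
    have : 2 * (p + q) ≤ max γ (2 * (p + q)) := le_max_right _ _
    linarith
  have hfrac : max C 0 * (ε₀ / (max C 0 + 1)) ≤ ε₀ := by
    rw [mul_div_assoc', div_le_iff₀ hK]
    nlinarith [hC0, hε₀]
  have hεle : max C 0 * (1 - (a / M) ^ 2) ^ (-p) * √d ≤ ε₀ * (1 - (a / M) ^ 2) ^ q :=
    calc max C 0 * (1 - (a / M) ^ 2) ^ (-p) * √d
        ≤ max C 0 * (1 - (a / M) ^ 2) ^ (-p) * (√(min c ((ε₀ / (max C 0 + 1)) ^ 2)) *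
            (1 - (a / M) ^ 2) ^ (max γ (2 * (p + q)) / 2)) :=
          mul_le_mul_of_nonneg_left hsqrt_d (mul_nonneg hC0 hpow)
      _ = (max C 0 * √(min c ((ε₀ / (max C 0 + 1)) ^ 2))) *
            ((1 - (a / M) ^ 2) ^ (-p) * (1 - (a / M) ^ 2) ^ (max γ (2 * (p + q)) / 2)) := by ring
      _ ≤ (max C 0 * (ε₀ / (max C 0 + 1))) * (1 - (a / M) ^ 2) ^ q :=
          mul_le_mul (mul_le_mul_of_nonneg_left hsqrt_c₂ hC0) hexp (mul_nonneg hpow hxg)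
            (mul_nonneg hC0 hεK.le)
      _ ≤ ε₀ * (1 - (a / M) ^ 2) ^ q :=
          mul_le_mul_of_nonneg_right hfrac (Real.rpow_nonneg hx0.le _)
  -- (iv) piece 2 on the region delivered by piece 1
  obtain ⟨M', a', 𝒟oc', hsub', hconv, hmod⟩ :=
    H₂M a hsub D 𝒟 hmax 𝒟oc _ hε0 hεle hclose'
  refine ⟨M', a', 𝒟oc', hsub', hfar, hconv, hmod.trans ?_⟩
  have hpow' : 0 ≤ (1 - (a / M) ^ 2) ^ (-p') := Real.rpow_nonneg hx0.le _
  have hmul : (1 - (a / M) ^ 2) ^ (-p') * (1 - (a / M) ^ 2) ^ (-p) =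
      (1 - (a / M) ^ 2) ^ (-(p + p')) := by
    rw [← Real.rpow_add hx0]
    congr 1
    ring
  calc C' * (1 - (a / M) ^ 2) ^ (-p') * (max C 0 * (1 - (a / M) ^ 2) ^ (-p) * √d)
      ≤ max C' 0 * (1 - (a / M) ^ 2) ^ (-p') * (max C 0 * (1 - (a / M) ^ 2) ^ (-p) * √d) :=
        mul_le_mul_of_nonneg_right (mul_le_mul_of_nonneg_right (le_max_left _ _) hpow') hε0
    _ = max C' 0 * max C 0 * ((1 - (a / M) ^ 2) ^ (-p') * (1 - (a / M) ^ 2) ^ (-p)) * √d := by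
        ring
    _ = max C' 0 * max C 0 * (1 - (a / M) ^ 2) ^ (-(p + p')) * √d := by rw [hmul]

end Summit.FinalStateConjecture.FinalStateConjecture.Cruxes.NearExtremalKappaCapture.StrategistR1

end

-- BC2/BC7-style probes (crux-strategist r1, decomposition attempt D-r1-2 and the crux itself)
#h21_crux_probe Summit.FinalStateConjecture.FinalStateConjecture.Cruxes.NearExtremalKappaCapture.StrategistR1.OrbitalKappaCapture summit := FinalStateConjecture
#h21_crux_probe Summit.FinalStateConjecture.FinalStateConjecture.Cruxes.NearExtremalKappaCapture.StrategistR1.AsymptoticFromOrbital summit := FinalStateConjecture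
#h21_crux_probe Summit.FinalStateConjecture.FinalStateConjecture.Theses.PhaseMixingCapture.NearExtremalKappaCapture summit := FinalStateConjecture
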